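import Mathlib
import Literature.Combinatorics.SimpleGraph.TreeSubtreeLayerCount   -- ★ `TreeLayers.ncard_sphere_eq_of_biregular` (spheres of a two-type bi-regular tree, closed form)

/-!
# R90 · S6 «Ch. 14.1–14.5 stable trace formula» — WAVE 6 helper W6-b: even spheres of a bi-regular tree

TREE COMBINATORICS for the full-Hecke fundamental-lemma count (DAG `R90_CLOSURE_DAG.md` row E1.3.5.1.3 «SPHERES = CARTAN
DOUBLE COSETS»): in a locally finite tree in which every vertex at EVEN distance from `x₀` has degree `a + 1` and every vertex
at ODD distance has degree `b + 1`, the sphere of radius `2m` (`m ≥ 1`) about `x₀` has `(a+1)·b·(ab)^(m−1)` vertices (for the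
Bruhat–Tits tree of `U(3)` at an inert place: `a = q³`, `b = q`; even spheres = hyperspecial vertices = `K₀ t_m K₀ ∕ K₀`).

PROOF = the parity TYPE FUNCTION `c v := [G.dist x₀ v odd] : Fin 2` (adjacent vertices have different types since in a tree
the distances from `x₀` of the two ends of an edge differ by exactly one, Mathlib `IsTree.dist_eq_dist_add_one_of_adj`) fed to
★ `Literature.Combinatorics.SimpleGraph.TreeLayers.ncard_sphere_eq_of_biregular` [Serre, *Trees* I.2.3, II.1.1]
(`#S_n(x₀) = (q_{c x₀} + 1) · q_{c′}^{⌊n∕2⌋} · q_{c x₀}^{⌊(n−1)∕2⌋}`), plus exponent bookkeeping.  The parity form for every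
radius `n ≥ 1` is recorded as `ncard_sphere_eq_of_parity_biregular_tree` (reused by W6-b′, the odd spheres).

Cell `hodgecm-mathlib`, crux H413 (`stmt-HodgeConjecture-24833`), route of record `HCCMUnconditional`; programme R90-TF
(brief `director/R90-BRIEF.v2.md` 1f40d54518340a35), section S6 (base `R90-C14`), seat R90-C14-p03 (g2); WAVE 6 sheet
`R90/R90-C14-plan/g2/S6_wave6_targets.v1.R90-C14-plan-g2.lean` 82d8032ceb473274 (AUDIT BOX S6#W6 CLEAN ×4), target W6-b
signature VERBATIM (ns without `.Wave6`).  Lane `--supports stmt-HodgeConjecture-24833 --as helper`; Mathlib + ★ Literature only,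
no definition, no kit, no posited object, no `sorry`.
HONEST LABEL: generic graph theory, count-neutral until the E1-c assembly consumes it; HC_CM is proved only modulo the 7 printed
citations (2 remaining named inputs: hLiu418 = stmt-HodgeConjecture-24832, h413 = stmt-HodgeConjecture-24833) until rung 0 closes.
-/

set_option autoImplicit false
-- the mandated namespace repeats the single-problem summit's segment (`HodgeConjecture.HodgeConjecture`)
set_option linter.dupNamespace false

open SimpleGraph

namespace Summit.HodgeConjecture.HodgeConjecture.R90.S6

variable {V : Type*} (G : SimpleGraph V)

/-- **Spheres of a parity-bi-regular tree, every radius** [Serre, *Trees* I.2.3, II.1.1]: if every vertex at even distance from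
`x₀` has degree `a + 1` and every vertex at odd distance has degree `b + 1`, then for `n ≥ 1` the sphere of radius `n` about `x₀`
has `(a + 1) · b^⌊n∕2⌋ · a^⌊(n−1)∕2⌋` vertices.  (★ `TreeLayers.ncard_sphere_eq_of_biregular` for the parity type function.) -/
theorem ncard_sphere_eq_of_parity_biregular_tree (hG : G.IsTree) [G.LocallyFinite] (x₀ : V) (a b : ℕ)
    (hdeg : ∀ x : V, G.degree x = if Even (G.dist x₀ x) then a + 1 else b + 1) (n : ℕ) (hn : 1 ≤ n) :
    {x : V | G.dist x₀ x = n}.ncard = (a + 1) * b ^ (n / 2) * a ^ ((n - 1) / 2) := by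
  -- the parity type function and the degree table `q`
  let c : V → Fin 2 := fun v => if Even (G.dist x₀ v) then 0 else 1
  let q : Fin 2 → ℕ := fun i => if i = 0 then a else b
  have hq0 : q 0 = a := by simp [q]
  have hq1 : q 1 = b := by simp [q]
  -- adjacent vertices have different parities (tree ⇒ distances from `x₀` along an edge differ by one)
  have hc : ∀ v w, G.Adj v w → c v ≠ c w := fun v w hadj => by
    simp only [c]
    rcases hG.dist_eq_dist_add_one_of_adj x₀ hadj with h | h
    · rw [h]
      by_cases hw : Even (G.dist x₀ w)
      · have hw' : ¬ Even (G.dist x₀ w + 1) := fun h' => Nat.even_add_one.1 h' hw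
        rw [if_neg hw', if_pos hw]; decide
      · have hw' : Even (G.dist x₀ w + 1) := Nat.even_add_one.2 hw
        rw [if_pos hw', if_neg hw]; decide
    · rw [h]
      by_cases hv : Even (G.dist x₀ v)
      · have hv' : ¬ Even (G.dist x₀ v + 1) := fun h' => Nat.even_add_one.1 h' hv
        rw [if_neg hv', if_pos hv]; decide
      · have hv' : Even (G.dist x₀ v + 1) := Nat.even_add_one.2 hv
        rw [if_pos hv', if_neg hv]; decide
  -- degrees read through the type function
  have hq : ∀ v, G.degree v = q (c v) + 1 := fun v => by
    rw [hdeg v]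
    by_cases h : Even (G.dist x₀ v) <;> simp [c, q, h]
  have h0 : c x₀ = 0 := by simp [c]
  have key := Literature.Combinatorics.SimpleGraph.TreeLayers.ncard_sphere_eq_of_biregular hG x₀ c hc q hq h0
    (show (0 : Fin 2) ≠ 1 by decide) hn
  rw [key, hq0, hq1]

/-- **(W6-b) even spheres of a bi-regular tree**: in a locally finite tree in which every vertex at EVEN distance from `x₀`
has degree `a + 1` and every vertex at ODD distance has degree `b + 1`, the sphere of radius `2m` (`m ≥ 1`) about `x₀` has
`(a+1)·b·(ab)^(m−1)` vertices (for the Bruhat–Tits tree of `U(3)` at an inert place: `a = q³`, `b = q`, even spheres =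
hyperspecial vertices = `K₀ t_m K₀ ∕ K₀`). [Serre, *Trees* II.1.1; Rogawski 1990 §4.9 counting road] -/
theorem ncard_sphere_even_of_biregular_tree (hG : G.IsTree) [G.LocallyFinite] (x₀ : V) (a b : ℕ)
    (hdeg : ∀ x : V, G.degree x = if Even (G.dist x₀ x) then a + 1 else b + 1) (m : ℕ) (hm : 1 ≤ m) :
    {x : V | G.dist x₀ x = 2 * m}.ncard = (a + 1) * b * (a * b) ^ (m - 1) := by
  rw [ncard_sphere_eq_of_parity_biregular_tree G hG x₀ a b hdeg (2 * m) (by omega)]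
  obtain ⟨k, rfl⟩ := Nat.exists_eq_add_of_le hm
  have e1 : 2 * (1 + k) / 2 = k + 1 := by omega
  have e2 : (2 * (1 + k) - 1) / 2 = k := by omega
  have e3 : 1 + k - 1 = k := by omega
  rw [e1, e2, e3, pow_succ, mul_pow]
  ring

end Summit.HodgeConjecture.HodgeConjecture.R90.S6
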